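import Summits.CriticalPhenomena.SAWScalingLimit.Theorems.SAWLeftRightFKGFKGToTraversalBoundGatesDefs
import Summits.CriticalPhenomena.SAWScalingLimit.Theorems.SAWLeftRightFKGFKGToTraversalBoundSlitPresentation
import HarnessLib

/-!
# Slit necklace, piece 3: the carriers of the mechanism — trace dichotomy, presentability, scope

Crux `SAWLeftRightFKG.FKGToTraversalBound` (stmt-CriticalPhenomena-1878), line
`gates-by-bubble-doors-by-fkg`, registered helpers `necklace_not_carrierPresentable_of_ringed`,
`necklace_presentable_iff`, `necklace_deepShellTight_of_carrierSplit` of the stub `stub_necklace`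
(`SAWCollarBound → GermExcursionMean → DeepShellTight`).

The necklace disintegrates the chord of a lattice domain `D_δ = discreteDomainGraph D.carrier δ` into
pieces each of which is the critical chord of an r2 carrier `(dom C' δ)_δ` obtained by SWEEPING slits and
frozen pieces onto the trace of a boundary walk (`stub_sweep` p100023, `stub_slitPresentation` p102570).
The sweep needs a boundary walk to start from: `D_δ` itself must be CARRIER-PRESENTABLE,
`∃ c C, discreteDomainGraph D.carrier δ = discreteDomainGraph (dom C δ) δ` (no endpoint clause).  This
file is the lattice geometry of that condition, all from ONE dichotomy:

* `adj_or_mem_support_one` — **trace dichotomy**: in an r2 graph, a `ℤ²`-neighbour `y` of a domain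
  vertex `x` is either a vertex of the boundary walk `C` or joined to `x` IN THE GRAPH (an off-trace unit
  segment from a carrier point stays in the carrier, `segment_subset_dom_one`);
* `adj_of_carrierPresentation` — hence a carrier-presentable `Ω_δ` is INDUCED on its non-isolated
  vertices (scope finding S-1 of the line: non-induced meshes are never presentable);
* `necklace_not_carrierPresentable_of_ringed` (registered, DEF-FREE) — **scope finding S-2**: if some
  site `s` isolated in `Ω_δ` has all four lattice neighbours among the non-isolated vertices of `Ω_δ`,
  then `Ω_δ` is NOT carrier-presentable although it may well be induced (a presenting walk would have
  to pass through `s`, entering from a neighbour, which would then lie on the trace and off the domain).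
  Such RINGED EXTERIOR SITES occur, e.g., for a cofinal set of meshes (density `≍` opening angle,
  generic tip position) at the tip of a re-entrant corner of `∂D` whose exterior wedge is thin and
  DIAGONAL: near the tip the wedge swallows the sites of the lattice diagonal closest to its axis and no
  other site, every dropped edge ends at a swallowed site (so the mesh IS induced), and the four
  neighbours of a swallowed site are domain vertices.  So the class `¬ Presentable ∧ InducedMesh` of
  `DeepShellTightInduced` is NOT covered by the necklace mechanism: the honest mechanism class is
  `CarrierPresentable ∧ ¬ Presentable`;
* `necklace_presentable_iff` (registered) — on a carrier-presentable mesh, presentability WITH the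
  endpoint clause (`Presentable`, the class of STUB 5) holds iff each endpoint has a lattice neighbour
  isolated in `D_δ`; so the necklace's meshes are exactly those where an endpoint is RINGED by four
  `D_δ`-neighbours (`adj_of_not_presentable`), the lattice form of "deep";
* `necklace_deepShellTight_of_carrierSplit` (registered) — the corrected glue for STUB 6:
  `ShellTightOn (CarrierPresentable ∧ ¬ Presentable)` (necklace proper) and
  `ShellTightOn (¬ CarrierPresentable)` (rough meshes: S-1 dropped edges AND S-2 ringed sites) give
  `DeepShellTight` (moduli by `max`, classes by cover; cf. `deepShellTight_of_split`).

Only theorems; no named fact; axioms are the standard three.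
-/

noncomputable section

open MeasureTheory Filter Topology Set Metric
open scoped NNReal ENNReal
open Literature.Probability.LatticeModels
open Literature.Probability.RandomPlanarGeometry
open Literature.Probability.RandomPlanarGeometry.SAW
open Literature.Topology.PlaneTopology
open Summit.CriticalPhenomena.SAWScalingLimit.Theses.SAWLeftRightFKG
open Summit.CriticalPhenomena.SAWScalingLimit.Theorems.FKGToTraversalBound.Negative
  (dom lrLE notMem_dom_of_mem_support)
open Summit.CriticalPhenomena.SAWScalingLimit.Theorems.FKGToTraversalBound.ExcursionDomination
  (segment_subset_dom_one meshGraph_adj_of_adj notMem_support_of_mem_meshVertices mem_meshDomain_of_adj)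
open Summit.CriticalPhenomena.SAWScalingLimit.Theorems.LeftRightFKG.Negative (pt meshPoint_one)
open Summit.CriticalPhenomena.SAWScalingLimit.Theorems.LeftRightFKG.CornerLoc (discreteDomainGraph_dom)

namespace Summit.CriticalPhenomena.SAWScalingLimit.Theorems.FKGToTraversalBound.GatesByBubbleDoorsByFKG

/-! ### Walk plumbing -/

/-- A vertex of a non-trivial walk has a neighbour (along the walk) among the vertices of the walk.
[folklore] -/
theorem exists_adj_mem_support {V : Type*} {G : SimpleGraph V} :
    ∀ {u v : V} (p : G.Walk u v), ¬ p.Nil → ∀ x ∈ p.support, ∃ y ∈ p.support, G.Adj x y := by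
  intro u v p
  induction p with
  | nil => intro hp; exact absurd SimpleGraph.Walk.Nil.nil hp
  | cons h q ih =>
    rename_i u' v' w'
    intro _ x hx
    rw [SimpleGraph.Walk.support_cons, List.mem_cons] at hx
    rcases hx with rfl | hx
    · exact ⟨v', by simp [q.start_mem_support], h⟩
    · by_cases hq : q.Nil
      · have hxv : x = v' := by
          rw [SimpleGraph.Walk.nil_iff_support_eq] at hq
          rw [hq, List.mem_singleton] at hx
          exact hx
        subst hxv
        exact ⟨u', by simp, h.symm⟩
      · obtain ⟨y, hy, hxy⟩ := ih hq x hx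
        exact ⟨y, by simp [hy], hxy⟩

/-! ### The trace dichotomy of an r2 carrier (mesh `1`, then any mesh) -/

/-- **Trace dichotomy at mesh `1`.**  In the r2 graph `(dom C 1)_1`, a `ℤ²`-neighbour `y` of a domain
vertex `x ∈ meshDomain` is either a vertex of the boundary walk `C` or ADJACENT to `x` in the graph: off
the trace the unit segment `[x, y]` stays in the carrier (`segment_subset_dom_one`), so `y` is a mesh
vertex mesh-adjacent to `x`, hence in the same (largest) component. [folklore] -/
theorem adj_or_mem_support_one {c : Site 2} (C : (zdGraph 2).Walk c c) {x y : Site 2}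
    (hx : x ∈ meshDomain (dom C 1) 1) (hxy : (zdGraph 2).Adj x y) :
    y ∈ C.support ∨ (discreteDomainGraph (dom C 1) 1).Adj x y := by
  by_cases hy : y ∈ C.support
  · exact Or.inl hy
  · right
    have hxV : x ∈ meshVertices (dom C 1) 1 := meshDomain_subset_meshVertices _ _ hx
    have hadj : (meshGraph (dom C 1) 1).Adj x y := meshGraph_adj_of_adj C hxy hxV hy
    have hxdom : pt x ∈ dom C 1 := by
      have h := hxV
      rw [mem_meshVertices_iff, meshPoint_one] at h
      exact h
    have hyV : y ∈ meshVertices (dom C 1) 1 := by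
      rw [mem_meshVertices_iff, meshPoint_one]
      exact segment_subset_dom_one C hxy hxdom hy (right_mem_segment _ _ _)
    have hyD : y ∈ meshDomain (dom C 1) 1 := mem_meshDomain_of_adj hyV hx hadj.symm
    exact discreteDomainGraph_adj_iff.2 ⟨hadj, hx, hyD⟩

/-- **Trace dichotomy at mesh `δ ≠ 0`** (transport along `CornerLoc.discreteDomainGraph_dom`): a
`ℤ²`-neighbour of a non-isolated vertex of `(dom C δ)_δ` is a vertex of `C` or adjacent to it in the
graph. [folklore] -/
theorem adj_or_mem_support {c : Site 2} (C : (zdGraph 2).Walk c c) {δ : ℝ} (hδ : δ ≠ 0)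
    {x y w : Site 2} (hx : (discreteDomainGraph (dom C δ) δ).Adj x w) (hxy : (zdGraph 2).Adj x y) :
    y ∈ C.support ∨ (discreteDomainGraph (dom C δ) δ).Adj x y := by
  have hG : discreteDomainGraph (dom C δ) δ = discreteDomainGraph (dom C 1) 1 :=
    discreteDomainGraph_dom C hδ
  rw [hG] at hx ⊢
  exact adj_or_mem_support_one C (discreteDomainGraph_adj_iff.1 hx).2.1 hxy

/-- A non-isolated vertex of `(dom C δ)_δ` is not a vertex of the boundary walk (its mesh point lies
in the carrier, where the index is non-zero; on the trace it is the junk `0`). [folklore] -/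
theorem notMem_support_of_adj {c : Site 2} (C : (zdGraph 2).Walk c c) {δ : ℝ} {x w : Site 2}
    (hx : (discreteDomainGraph (dom C δ) δ).Adj x w) : x ∉ C.support :=
  notMem_support_of_mem_meshVertices C δ
    (meshDomain_subset_meshVertices _ _ (discreteDomainGraph_adj_iff.1 hx).2.1)

/-- **A carrier-presentable lattice domain is induced on its non-isolated vertices** (scope finding
S-1 of the line, made quantitative): if `Ω_δ = (dom C δ)_δ` as graphs, two `ℤ²`-adjacent non-isolated
vertices of `Ω_δ` are adjacent in `Ω_δ`. [folklore] -/
theorem adj_of_carrierPresentation {Ω : Set ℂ} {δ : ℝ} (hδ : δ ≠ 0) {c : Site 2}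
    {C : (zdGraph 2).Walk c c} (hG : discreteDomainGraph Ω δ = discreteDomainGraph (dom C δ) δ)
    {x y x' y' : Site 2} (hx : (discreteDomainGraph Ω δ).Adj x x')
    (hy : (discreteDomainGraph Ω δ).Adj y y') (hxy : (zdGraph 2).Adj x y) :
    (discreteDomainGraph Ω δ).Adj x y := by
  rw [hG] at hx hy ⊢
  rcases adj_or_mem_support C hδ hx hxy with hyC | h
  · exact absurd hyC (notMem_support_of_adj C hy)
  · exact h

/-! ### Scope finding S-2: ringed exterior sites -/

/-- **Registered helper `necklace_not_carrierPresentable_of_ringed`** (crux stmt-CriticalPhenomena-1878,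
stub `stub_necklace`; DEF-FREE): **a lattice domain with a RINGED isolated site is not an r2 graph.**
If `s` is isolated in `Ω_δ` (`δ > 0`) while every `ℤ²`-neighbour of `s` is a non-isolated vertex of
`Ω_δ`, then `Ω_δ ≠ (dom C δ)_δ` for every closed lattice walk `C`: by the trace dichotomy `s` would be
a vertex of `C`, and the walk enters `s` from a lattice neighbour, a vertex of `C` — but vertices of `C`
are off the carrier, while the neighbours of `s` are domain vertices.  (At an INDUCED mesh this happens
whenever an exterior lattice site near the tip of a thin diagonal exterior wedge of `∂D` has its four
neighbours in `D_δ`: such meshes are in the class of `DeepShellTightInduced` but carry no necklace.)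
[folklore] -/
theorem necklace_not_carrierPresentable_of_ringed :
    ∀ (Ω : Set ℂ) (δ : ℝ) (s : Site 2), 0 < δ →
      (∀ w : Site 2, (zdGraph 2).Adj s w → ∃ w' : Site 2, (discreteDomainGraph Ω δ).Adj w w') →
      (∀ w : Site 2, ¬ (discreteDomainGraph Ω δ).Adj s w) →
      ∀ (c : Site 2) (C : (zdGraph 2).Walk c c),
        discreteDomainGraph Ω δ ≠ discreteDomainGraph (dom C δ) δ := by
  intro Ω δ s hδ hring hiso c C hG
  -- one neighbour of `s`, say east
  set e : Site 2 := s + Pi.single 0 1 with he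
  have hse : (zdGraph 2).Adj s e := (zdGraph_adj_iff _ _).2 ⟨0, Or.inl rfl⟩
  obtain ⟨e', hee'⟩ := hring e hse
  rw [hG] at hee'
  -- by the dichotomy at `e`, the site `s` is a vertex of `C`
  have hsC : s ∈ C.support := by
    rcases adj_or_mem_support C hδ.ne' hee' hse.symm with h | h
    · exact h
    · exact absurd (hG ▸ h.symm) (hiso e)
  -- `C` is not trivial: `e` is a domain vertex, so the carrier is non-empty
  have hC : ¬ C.Nil := by
    intro hnil
    have heD : e ∈ meshDomain (dom C δ) δ := (discreteDomainGraph_adj_iff.1 hee').2.1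
    have heV := meshDomain_subset_meshVertices _ _ heD
    rw [mem_meshVertices_iff] at heV
    -- the loop of a trivial walk is constant, its index is `0`
    have hcnil : C = SimpleGraph.Walk.nil := SimpleGraph.Walk.eq_nil_iff_nil.2 hnil
    subst hcnil
    have hconst : (fun t : ℝ => Set.IccExtend zero_le_one
        ((SimpleGraph.Walk.nil : (zdGraph 2).Walk c c).toCurve (meshPoint δ)) t - meshPoint δ e) =
        fun _ => meshPoint δ c - meshPoint δ e := by
      funext t
      have hmem : Set.IccExtend zero_le_one
          ((SimpleGraph.Walk.nil : (zdGraph 2).Walk c c).toCurve (meshPoint δ)) t ∈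
            Set.range ((SimpleGraph.Walk.nil : (zdGraph 2).Walk c c).toCurve (meshPoint δ)) :=
        ⟨_, rfl⟩
      rw [SimpleGraph.Walk.range_toCurve_nil, Set.mem_singleton_iff] at hmem
      rw [hmem]
    have hzero : wind (fun t : ℝ => Set.IccExtend zero_le_one
        ((SimpleGraph.Walk.nil : (zdGraph 2).Walk c c).toCurve (meshPoint δ)) t - meshPoint δ e) = 0 := by
      rw [hconst]
      exact wind_const _
    exact heV hzero
  -- the walk enters `s` from a lattice neighbour `p`, a vertex of `C` …
  obtain ⟨p, hpC, hsp⟩ := exists_adj_mem_support C hC s hsC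
  -- … which is a domain vertex, hence off the trace: contradiction
  obtain ⟨p', hpp'⟩ := hring p hsp
  rw [hG] at hpp'
  exact notMem_support_of_adj C hpp' hpC

/-! ### Presentability with the endpoint clause -/

/-- On any mesh, a vertex `u'` of a presenting walk is ISOLATED in the presented graph. [folklore] -/
theorem isolated_of_mem_support {Ω : Set ℂ} {δ : ℝ} {c : Site 2} {C : (zdGraph 2).Walk c c}
    (hG : discreteDomainGraph Ω δ = discreteDomainGraph (dom C δ) δ) {u' : Site 2}
    (hu' : u' ∈ C.support) : ∀ w : Site 2, ¬ (discreteDomainGraph Ω δ).Adj u' w := by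
  intro w h
  rw [hG] at h
  exact notMem_support_of_adj C h hu'

/-- **Registered helper `necklace_presentable_iff`** (crux stmt-CriticalPhenomena-1878, stub
`stub_necklace`): **presentability with the endpoint clause, characterised on the lattice.**  For
non-isolated endpoints `u, v` of `D_δ` (`δ > 0`), `Presentable D δ u v` (the class of STUB 5: `D_δ` is
an r2 graph with `u`, `v` lattice-adjacent to vertices of the boundary walk) holds iff `D_δ` is
carrier-presentable AND each endpoint has a `ℤ²`-neighbour isolated in `D_δ` (forward: vertices of `C`
are isolated, `isolated_of_mem_support`; backward: by the trace dichotomy an isolated neighbour of a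
domain vertex lies on EVERY presenting walk). [folklore] -/
theorem necklace_presentable_iff :
    ∀ (D : DobrushinDomain) (δ : ℝ) (u v : Site 2), 0 < δ →
      (∃ w : Site 2, (discreteDomainGraph D.carrier δ).Adj u w) →
      (∃ w : Site 2, (discreteDomainGraph D.carrier δ).Adj v w) →
      (Presentable D δ u v ↔
        (∃ (c : Site 2) (C : (zdGraph 2).Walk c c),
            discreteDomainGraph D.carrier δ = discreteDomainGraph (dom C δ) δ) ∧
          (∃ u' : Site 2, (zdGraph 2).Adj u u' ∧
            ∀ w : Site 2, ¬ (discreteDomainGraph D.carrier δ).Adj u' w) ∧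
          (∃ v' : Site 2, (zdGraph 2).Adj v v' ∧
            ∀ w : Site 2, ¬ (discreteDomainGraph D.carrier δ).Adj v' w)) := by
  intro D δ u v hδ hu hv
  constructor
  · rintro ⟨c, u', v', C, hu', hv', huu', hvv', hG⟩
    exact ⟨⟨c, C, hG⟩, ⟨u', huu', isolated_of_mem_support hG hu'⟩,
      ⟨v', hvv', isolated_of_mem_support hG hv'⟩⟩
  · rintro ⟨⟨c, C, hG⟩, ⟨u', huu', hu'iso⟩, ⟨v', hvv', hv'iso⟩⟩
    obtain ⟨w, huw⟩ := hu
    obtain ⟨z, hvz⟩ := hv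
    have hu'C : u' ∈ C.support := by
      rw [hG] at huw
      rcases adj_or_mem_support C hδ.ne' huw huu' with h | h
      · exact h
      · exact absurd (hG ▸ h.symm) (hu'iso u)
    have hv'C : v' ∈ C.support := by
      rw [hG] at hvz
      rcases adj_or_mem_support C hδ.ne' hvz hvv' with h | h
      · exact h
      · exact absurd (hG ▸ h.symm) (hv'iso v)
    exact ⟨c, u', v', C, hu'C, hv'C, huu', hvv', hG⟩

/-- **The necklace's meshes, on the lattice**: at a carrier-presentable mesh which is NOT presentable
with the endpoint clause, one of the two (non-isolated) endpoints is RINGED — every lattice neighbour is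
joined to it in `D_δ` (the lattice form of a deep endpoint; by the trace dichotomy a non-adjacent
neighbour would be an isolated trace vertex). [folklore] -/
theorem adj_of_not_presentable {D : DobrushinDomain} {δ : ℝ} (hδ : 0 < δ) {u v : Site 2}
    (hu : ∃ w : Site 2, (discreteDomainGraph D.carrier δ).Adj u w)
    (hv : ∃ w : Site 2, (discreteDomainGraph D.carrier δ).Adj v w)
    (hC : ∃ (c : Site 2) (C : (zdGraph 2).Walk c c),
      discreteDomainGraph D.carrier δ = discreteDomainGraph (dom C δ) δ)
    (hnp : ¬ Presentable D δ u v) :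
    (∀ w : Site 2, (zdGraph 2).Adj u w → (discreteDomainGraph D.carrier δ).Adj u w) ∨
      (∀ w : Site 2, (zdGraph 2).Adj v w → (discreteDomainGraph D.carrier δ).Adj v w) := by
  obtain ⟨c, C, hG⟩ := hC
  by_contra h
  rw [not_or, not_forall, not_forall] at h
  obtain ⟨⟨u', hu'⟩, ⟨v', hv'⟩⟩ := h
  rw [Classical.not_imp] at hu' hv'
  apply hnp
  rw [necklace_presentable_iff D δ u v hδ hu hv]
  obtain ⟨w, huw⟩ := hu
  obtain ⟨z, hvz⟩ := hv
  refine ⟨⟨c, C, hG⟩, ⟨u', hu'.1, ?_⟩, ⟨v', hv'.1, ?_⟩⟩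
  · -- `u'` is a trace vertex, hence isolated
    have hu'C : u' ∈ C.support := by
      rw [hG] at huw hu'
      rcases adj_or_mem_support C hδ.ne' huw hu'.1 with h | h
      · exact h
      · exact absurd h hu'.2
    exact isolated_of_mem_support hG hu'C
  · have hv'C : v' ∈ C.support := by
      rw [hG] at hvz hv'
      rcases adj_or_mem_support C hδ.ne' hvz hv'.1 with h | h
      · exact h
      · exact absurd h hv'.2
    exact isolated_of_mem_support hG hv'C

/-! ### The corrected split of the deep fragment -/

/-- **Registered helper `necklace_deepShellTight_of_carrierSplit`** (crux stmt-CriticalPhenomena-1878,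
stub `stub_necklace`): **the deep fragment splits along CARRIER-presentability.**  Per-shell tightness
at some modulus on the necklace's meshes (carrier-presentable, not presentable with the endpoint
clause) and at some modulus on the rough meshes (not carrier-presentable: the non-induced meshes of S-1
and the ringed-site meshes of S-2) give `DeepShellTight` (moduli by `max`, `shellTightOn_mono`; classes
by `shellTightOn_of_cover`). [folklore] -/
theorem necklace_deepShellTight_of_carrierSplit :
    (∃ M : ℝ, 1 < M ∧ ∀ (D : DobrushinDomain) (a b : ℝ → Site 2), IsEndpointApprox D a b →
      ShellTightOn (fun δ => (∃ (c : Site 2) (C : (zdGraph 2).Walk c c),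
          discreteDomainGraph D.carrier δ = discreteDomainGraph (dom C δ) δ) ∧
        ¬ Presentable D δ (a δ) (b δ)) M D a b) →
    (∃ M : ℝ, 1 < M ∧ ∀ (D : DobrushinDomain) (a b : ℝ → Site 2), IsEndpointApprox D a b →
      ShellTightOn (fun δ => ¬ ∃ (c : Site 2) (C : (zdGraph 2).Walk c c),
          discreteDomainGraph D.carrier δ = discreteDomainGraph (dom C δ) δ) M D a b) →
    DeepShellTight := by
  rintro ⟨M₁, hM₁, H₁⟩ ⟨M₂, -, H₂⟩
  refine ⟨max M₁ M₂, lt_max_of_lt_left hM₁, fun D a b hab => ?_⟩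
  refine shellTightOn_of_cover (shellTightOn_mono (le_max_left _ _) (H₁ D a b hab))
    (shellTightOn_mono (le_max_right _ _) (H₂ D a b hab)) fun δ hP => ?_
  by_cases hc : ∃ (c : Site 2) (C : (zdGraph 2).Walk c c),
      discreteDomainGraph D.carrier δ = discreteDomainGraph (dom C δ) δ
  · exact Or.inl ⟨hc, hP⟩
  · exact Or.inr hc

end Summit.CriticalPhenomena.SAWScalingLimit.Theorems.FKGToTraversalBound.GatesByBubbleDoorsByFKG

end
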